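import Summits.QuantumAdvantage.QuantumAdvantage.Theorems.LinnikCubicClassGroupsDegreeOnePrimesEscapeFrobeniusLeastDegOnePrimeAll
import Summits.QuantumAdvantage.QuantumAdvantage.Theorems.LinnikCubicClassGroupsDegreeOnePrimesEscapeChebotarevElement
import HarnessLib

/-!
# The Lagarias–Montgomery–Odlyzko theorem over an ARBITRARY base field

Topic `Summits/QuantumAdvantage/QuantumAdvantage/Theorems`, cell B2b-1 (linnik-cubic), PART A (gen 16); helper
toward the crux `DegreeOnePrimesEscape` (stmt-QuantumAdvantage-11543).  HONEST FRAMING: the value of this file is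
a THEOREM (kernel-checked, GRH-free) — NOT summit progress.

Lagarias–Montgomery–Odlyzko state their Theorem 1.1 for a Galois extension `L/K` of an ARBITRARY number field
`K`: "for every finite extension `K` of `ℚ`, every finite Galois extension `L` of `K` and every conjugacy class
`C` of `Gal(L/K)`, there exists a prime ideal `𝔭` of `K` which is unramified in `L`, for which `[L/K, 𝔭] = C`,
for which `N_{K/ℚ} 𝔭` is a rational prime, and which satisfies `N_{K/ℚ} 𝔭 ≤ 2 d_L^{A₁}`"
[LagariasMontgomeryOdlyzko1979, Theorem 1.1, p. 272].  The tree's `exists_prime_isArithFrobAt_le_all`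
(`…ChebotarevElementAll.lean`, gen 13) is the case `K = ℚ`.  This file removes that restriction:

**Theorem** (`exists_prime_isArithFrobAt_le_relative`, `…_discr_rpow`).  For `n > 1` there is `L = L(n) > 0`
such that for every tower `ℚ ⊆ F ⊆ N` of number fields with `N/F` Galois and `[N:ℚ] = n`, and every
`σ ∈ Gal(N/F)`, there is a prime `𝔔` of `N` at which `σ` is an arithmetic Frobenius OVER `𝓞_F`
(`σ x ≡ x^{N𝔭} (mod 𝔔)`, `𝔭 = 𝔔 ∩ 𝓞_F`, i.e. `[N/F, 𝔭] = C(σ)`), with `N_{F/ℚ} 𝔭 = p` a rational prime,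
`p ∤ d_N` (so `𝔔` is unramified over `ℤ`, a fortiori over `𝓞_F`), and `p ≤ Q^{L}`, `Q = |d_N| nⁿ`
(resp. `p ≤ |d_N|^{L}`).  The exponent depends on the absolute degree `n` only (LMO: an absolute `A₁`;
here inexplicit and degree-dependent, as everywhere in this chain).

Proof (Deuring's reduction, as in LMO §3): `E := N^{⟨σ⟩} ⊇ F`, `N/E` cyclic; the every-base cyclic
theorem `exists_degOnePrime_galFrob_eq_absNorm_le_all` gives a prime `𝔭_E` of `E` with `N𝔭_E = p` prime,
`p ∤ d_N`, `Frob_{N/E}(𝔭_E) = σ`, `p ≤ Q^{L}`; at a prime `𝔔 ∣ 𝔭_E` of `N` the congruence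
`σ x ≡ x^{p} (mod 𝔔)` is the Frobenius congruence over `𝓞_F` as well, because the residue field of
`𝔭 = 𝔭_E ∩ 𝓞_F` embeds into `𝓞_E/𝔭_E = 𝔽_p` and so has exactly `p` elements (`natCard_quot_eq_of_liesOver_of_prime`).
-/

noncomputable section

open Complex Real Finset NumberField IsDedekindDomain
open scoped NumberField nonZeroDivisors Classical

namespace Summit.QuantumAdvantage.QuantumAdvantage.Theorems.DegreeOnePrimesEscape

open Literature.NumberTheory.LFunctions Literature.NumberTheory.LFunctions.NumberField
  Literature.NumberTheory.GaloisRepresentations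

/-- **A residue ring embedded in a field with `p` elements has `p` elements.**  If `P ⊆ B` lies over the proper
ideal `𝔭 ⊆ A` and `B/P` has prime cardinality `ℓ`, then `A/𝔭` has cardinality `ℓ` (the image of
`A/𝔭 ↪ B/P` is a nontrivial additive subgroup of a group of prime order). [folklore] -/
theorem natCard_quot_eq_of_liesOver_of_prime {A B : Type*} [CommRing A] [CommRing B] [Algebra A B]
    (P : Ideal B) (𝔭 : Ideal A) [P.LiesOver 𝔭] (h𝔭 : 𝔭 ≠ ⊤) {ℓ : ℕ} (hℓ : ℓ.Prime)
    (hP : Nat.card (B ⧸ P) = ℓ) : Nat.card (A ⧸ 𝔭) = ℓ := by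
  have hinj : Function.Injective (algebraMap (A ⧸ 𝔭) (B ⧸ P)) :=
    FaithfulSMul.algebraMap_injective _ _
  haveI : Finite (B ⧸ P) := Nat.finite_of_card_ne_zero (by rw [hP]; exact hℓ.ne_zero)
  have hcard : Nat.card (A ⧸ 𝔭) = Nat.card ((algebraMap (A ⧸ 𝔭) (B ⧸ P)).toAddMonoidHom.range) :=
    Nat.card_congr (AddMonoidHom.ofInjective (f := (algebraMap (A ⧸ 𝔭) (B ⧸ P)).toAddMonoidHom) hinj).toEquiv
  have hdvd : Nat.card (A ⧸ 𝔭) ∣ ℓ := by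
    rw [hcard, ← hP]; exact AddSubgroup.card_addSubgroup_dvd_card _
  haveI : Nontrivial (A ⧸ 𝔭) := Ideal.Quotient.nontrivial_iff.mpr h𝔭
  rcases (Nat.dvd_prime hℓ).1 hdvd with h1 | h
  · exfalso
    haveI : Finite (A ⧸ 𝔭) := Nat.finite_of_card_ne_zero (by rw [h1]; exact one_ne_zero)
    have := Finite.one_lt_card (α := A ⧸ 𝔭)
    omega
  · exact h

variable {F N : Type} [Field F] [NumberField F] [Field N] [NumberField N] [Algebra F N]

/-- **Frobenius over `𝓞_E` at a degree-one prime is Frobenius over `𝓞_F`, for `F ⊆ E ⊆ N`.**  Let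
`σ ∈ Gal(N/F)` fix the intermediate field `E`, `𝔔` a prime of `N` above the prime `𝔭_E` of `E` with
`N𝔭_E = p` prime.  If `σ` (as an element of `Gal(N/E)`) is an arithmetic Frobenius at `𝔔` over `𝓞_E`, then
`σ` is an arithmetic Frobenius at `𝔔` over `𝓞_F`, and `𝔔 ∩ 𝓞_F` has norm `p`. [folklore] -/
theorem isArithFrobAt_of_absNorm_prime_relative (E : IntermediateField F N) (σ : N ≃ₐ[F] N)
    (hσ : σ ∈ E.fixingSubgroup) (v : HeightOneSpectrum (𝓞 E)) {Q : Ideal (𝓞 N)}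
    (hQ : Q ∈ v.asIdeal.primesOver (𝓞 N))
    (hfrob : IsArithFrobAt (𝓞 E) (IntermediateField.fixingSubgroupEquiv E ⟨σ, hσ⟩) Q)
    {p : ℕ} (hp : p.Prime) (hv : Ideal.absNorm v.asIdeal = p) :
    IsArithFrobAt (𝓞 F) σ Q ∧ Ideal.absNorm (Q.under (𝓞 F)) = p := by
  haveI : Q.IsPrime := hQ.1
  have hover : v.asIdeal = Q.under (𝓞 E) := hQ.2.over
  have hexpE : Nat.card (𝓞 E ⧸ Q.under (𝓞 E)) = p := by
    rw [← hover, ← Submodule.cardQuot_apply, ← Ideal.absNorm_apply, hv]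
  haveI : (Q.under (𝓞 E)).LiesOver (Q.under (𝓞 F)) := ⟨(Ideal.under_under (B := 𝓞 E) Q).symm⟩
  have hexpF : Nat.card (𝓞 F ⧸ Q.under (𝓞 F)) = p :=
    natCard_quot_eq_of_liesOver_of_prime (Q.under (𝓞 E)) (Q.under (𝓞 F))
      (Ideal.IsPrime.under (𝓞 F) Q).ne_top hp hexpE
  refine ⟨?_, by rw [Ideal.absNorm_apply, Submodule.cardQuot_apply, hexpF]⟩
  intro x
  have h := hfrob x
  rw [hexpF]
  rw [hexpE] at h
  -- the two actions of `σ` on `𝓞 N` agree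
  have hact : (MulSemiringAction.toAlgHom (𝓞 E) (𝓞 N) (IntermediateField.fixingSubgroupEquiv E ⟨σ, hσ⟩)) x =
      (MulSemiringAction.toAlgHom (𝓞 F) (𝓞 N) σ) x := by
    apply Subtype.ext
    rfl
  rw [← hact]
  exact h

/-- **Lagarias–Montgomery–Odlyzko's Theorem 1.1 over an arbitrary base field** (see the module docstring):
least prime `𝔭` of `F` with prescribed Frobenius CLASS — indeed element — in `Gal(N/F)`, `N𝔭 = p` prime,
`p ∤ d_N`, `p ≤ (|d_N| nⁿ)^{L(n)}`. [cite: LagariasMontgomeryOdlyzko1979, Theorem 1.1] [cite: Weiss1983, Theorem 6.1] -/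
theorem exists_prime_isArithFrobAt_le_relative (n : ℕ) (hn : 1 < n) :
    ∃ L : ℝ, 0 < L ∧ ∀ (F N : Type) [Field F] [NumberField F] [Field N] [NumberField N] [Algebra F N]
      [IsGalois F N], Module.finrank ℚ N = n → ∀ σ : N ≃ₐ[F] N,
        ∃ (Q : Ideal (𝓞 N)) (_ : Q.IsMaximal), IsArithFrobAt (𝓞 F) σ Q ∧ Algebra.IsUnramifiedAt ℤ Q ∧
          (Ideal.absNorm (Q.under (𝓞 F))).Prime ∧
          ¬ ((Ideal.absNorm (Q.under (𝓞 F)) : ℤ) ∣ NumberField.discr N) ∧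
          (Ideal.absNorm (Q.under (𝓞 F)) : ℝ) ≤ ThornerZaman.condQn N ^ L := by
  obtain ⟨L, hL, hmain⟩ := exists_degOnePrime_galFrob_eq_absNorm_le_all n hn
  refine ⟨L, hL, fun F N _ _ _ _ _ _ hNn σ ↦ ?_⟩
  -- the fixed field of `⟨σ⟩`
  set H : Subgroup (N ≃ₐ[F] N) := Subgroup.zpowers σ with hH
  set E : IntermediateField F N := IntermediateField.fixedField H with hE
  have hfix : E.fixingSubgroup = H := IntermediateField.fixingSubgroup_fixedField H
  have hσE : σ ∈ E.fixingSubgroup := by rw [hfix]; exact Subgroup.mem_zpowers σ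
  haveI : IsCyclic E.fixingSubgroup := by rw [hfix]; infer_instance
  haveI : IsCyclic (N ≃ₐ[E] N) :=
    isCyclic_of_surjective (IntermediateField.fixingSubgroupEquiv E).toMonoidHom
      (IntermediateField.fixingSubgroupEquiv E).surjective
  set τ : N ≃ₐ[E] N := IntermediateField.fixingSubgroupEquiv E ⟨σ, hσE⟩ with hτ
  obtain ⟨v, -, hfrobv, hprime, hnd, hle⟩ := hmain E N hNn τ
  obtain ⟨Q, hQ, hfrobQ⟩ := galFrob_spec E N v
  rw [hfrobv] at hfrobQ
  obtain ⟨hF, hnorm⟩ := isArithFrobAt_of_absNorm_prime_relative E σ hσE v hQ hfrobQ hprime rfl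
  haveI : Q.IsPrime := hQ.1
  have hQ0 : Q ≠ ⊥ := Ideal.ne_bot_of_mem_primesOver v.ne_bot hQ
  haveI hQmax : Q.IsMaximal := hQ.1.isMaximal hQ0
  -- `p ∈ 𝔔`, so `𝔔` is unramified over `ℤ` (`p ∤ d_N`, Dedekind)
  have hpQ : ((Ideal.absNorm v.asIdeal : ℤ) : 𝓞 N) ∈ Q := by
    haveI := hQ.2
    have h2 : algebraMap (𝓞 E) (𝓞 N) (Ideal.absNorm v.asIdeal : 𝓞 E) ∈ Q :=
      (Ideal.mem_of_liesOver Q v.asIdeal _).mp (Ideal.absNorm_mem _)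
    rw [map_natCast] at h2
    rw [Int.cast_natCast]
    exact h2
  have hunr : Algebra.IsUnramifiedAt ℤ Q :=
    (NumberField.not_dvd_discr_iff_forall_mem N (𝓞 N) (Nat.prime_iff_prime_int.mp hprime)).mp hnd Q
      inferInstance hpQ
  refine ⟨Q, hQmax, hF, hunr, ?_, ?_, ?_⟩
  · rw [hnorm]; exact hprime
  · rw [hnorm]; exact hnd
  · rw [hnorm]; exact hle

/-- **The same with the bound `N𝔭 ≤ |d_N|^{L'}`** (`Q = |d_N| nⁿ ≤ |d_N|^{1 + n log n/log 3}`), and the relative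
unramifiedness spelled out. [cite: LagariasMontgomeryOdlyzko1979, Theorem 1.1] -/
theorem exists_prime_isArithFrobAt_le_relative_discr_rpow (n : ℕ) (hn : 1 < n) :
    ∃ L : ℝ, 0 < L ∧ ∀ (F N : Type) [Field F] [NumberField F] [Field N] [NumberField N] [Algebra F N]
      [IsGalois F N], Module.finrank ℚ N = n → ∀ σ : N ≃ₐ[F] N,
        ∃ (Q : Ideal (𝓞 N)) (_ : Q.IsMaximal), IsArithFrobAt (𝓞 F) σ Q ∧
          Algebra.IsUnramifiedAt ℤ Q ∧ Algebra.IsUnramifiedAt (𝓞 F) Q ∧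
          (Ideal.absNorm (Q.under (𝓞 F))).Prime ∧
          ¬ ((Ideal.absNorm (Q.under (𝓞 F)) : ℤ) ∣ NumberField.discr N) ∧
          (Ideal.absNorm (Q.under (𝓞 F)) : ℝ) ≤ ((NumberField.discr N).natAbs : ℝ) ^ L := by
  obtain ⟨L, hL, hmain⟩ := exists_prime_isArithFrobAt_le_relative n hn
  have hn0 : (0 : ℝ) < n := by exact_mod_cast (lt_trans Nat.zero_lt_one hn)
  have hlogn : 0 ≤ Real.log n := Real.log_nonneg (by exact_mod_cast hn.le)
  set e : ℝ := 1 + n * Real.log n / Real.log 3 with he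
  have hlog3 : 0 < Real.log 3 := Real.log_pos (by norm_num)
  have he0 : 0 ≤ (n : ℝ) * Real.log n / Real.log 3 := by positivity
  have he1 : 1 ≤ e := by rw [he]; linarith
  refine ⟨e * L, by positivity, fun F N _ _ _ _ _ _ hNn σ ↦ ?_⟩
  obtain ⟨Q, hQmax, hF, hunr, hprime, hnd, hple⟩ := hmain F N hNn σ
  haveI := hQmax
  haveI := hunr
  refine ⟨Q, hQmax, hF, hunr, Algebra.IsUnramifiedAt.of_restrictScalars ℤ Q, hprime, hnd, hple.trans ?_⟩
  have hN1 : 1 < Module.finrank ℚ N := by rw [hNn]; exact hn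
  have hQd := condQn_le_natAbs_discr_rpow N hN1
  rw [hNn] at hQd
  have hd0 : (0 : ℝ) ≤ ((NumberField.discr N).natAbs : ℝ) := Nat.cast_nonneg _
  have hQ0 : (0 : ℝ) ≤ ThornerZaman.condQn N := by
    have := ThornerZaman.twelve_le_condQn (K := N) hN1; linarith
  calc ThornerZaman.condQn N ^ L ≤ (((NumberField.discr N).natAbs : ℝ) ^ e) ^ L :=
        Real.rpow_le_rpow hQ0 hQd hL.le
    _ = ((NumberField.discr N).natAbs : ℝ) ^ (e * L) := by rw [Real.rpow_mul hd0]

end Summit.QuantumAdvantage.QuantumAdvantage.Theorems.DegreeOnePrimesEscape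

end
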